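import Summits.BirchSwinnertonDyer.BirchSwinnertonDyer.Theorems.ByReductionTypeAtTwoTowerFiltrationExponent
import HarnessLib

/-!
# The MODULE-FILTRATION certificate, part 5: the EXPONENT gap certificate at `p = 2` over `ℚ` —
# `e + t < 2ⁿ ⇒ O1.TowerGapAtTwo W` (route ByReductionTypeAtTwo, crux `MultUpperHalfAtTwo`,
# item stmt-BirchSwinnertonDyer-19922; seat bsd-2adic-mult-2 GEN 11, part 2 of 2 of the kernel)

HONEST FRAMING (cell `bsd-2adic`, run/shared/lean/pub/bsd-2adic/, HUMAN RULINGS D-0036/D-0054/D-0074): THEOREMS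
ONLY; nothing asserted; no definition; no new named fact; closes nothing by itself; BSD is not proved by any
of this. PARTITION: X5@2 mult (K4ᵐ, B1·O1) × p = 2 — types-the-object-of (a sharper per-class certificate
format for item 19922 AT the class); closes none. bears_on: K4 (route-BirchSwinnertonDyer-ByReductionTypeAtTwo
item 19922).

Part 4 (`…TowerFiltrationExponent`) proved `ν^{t}(A_n[p]) ⊆ Sel_{p^∞}(E/K_n)[p]` as soon as every local block
`C_v^{#R_v}` is `≤ 2^t` (`ν = conj_γ − id`). This part reads T10's gap off it at `p = 2` over `ℚ`:
* **`towerGapAtTwo_of_exponent_localKernelBounds`** — odd torsion order, a layer `n`, `e + t < 2ⁿ`, the EXPONENT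
  certificate `ν^[e] z = 0` for every `2`-torsion class `z ∈ Sel_{2^∞}(E/ℚ_n)` (every cyclotomic `κ`, topological
  generator `γ`; ENGINE A: `s(e) = s(2ⁿ)` in the `S2| SIGMA` vector), tower-1's local interface
  `(S, C, N, h0, hC, hN)` at level `n`, and the block bounds `C_v^{N_v} ≤ 2^t` ⟹ `O1.TowerGapAtTwo W` with
  `(m, k) = (e + t, 1)`: `ν^{e+t}` kills `A_n[2]`, so `#X/(2,T^{e+t+1})X = #A_n[2] = #X/(2,T^{e+t})X`
  (part 2's one-layer count) `< 2 · #X/(2,T^{e+t})X`;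
* **`towerGapAtTwo_of_exponent_localKernelBounds_sharp`** — the same with tower-1's SHARP covers built in
  (`N_v = 1` over `2`, `2^{min(n, v₂(ℓ_v²−1)−3)}` at odd `v`).
Compared with part 3's window `s(m+w) − s(m) + c₂ + Σ_n < w` (⟺ `b₁ + c₂ + Σ_n < 2ⁿ` for the concave profiles
the engine returns), the requirement is `b₁ + max(c₂, max_ℓ bits_ℓ · 2^{min(n,e_ℓ)}) < 2ⁿ`: only the LARGEST
local block is charged.

WHAT IS DISPLAYED, NOT PROVED (in the doors, next files): the same PRINT/MEMO binders as the window doors; the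
CERTIFICATE binder becomes the one exponent statement `hstat` (engine: ENGINE A + `S2| SIGMA`, evidence tier).

References: R. Greenberg, LNM 1716 (1999), §1 p. 60, §3 pp. 85–90 (Lemmas 3.1–3.5); L. Washington,
*Introduction to Cyclotomic Fields*, §13.1–13.2.
-/
set_option autoImplicit false
-- the Theorems namespace of this sub repeats the summit name by design (D-0017 nested layout: Summit.<S>.<Sub>)
set_option linter.dupNamespace false

noncomputable section

open scoped Classical

open NumberField IsDedekindDomain WeierstrassCurve Literature.NumberTheory.EllipticCurves
  Literature.NumberTheory.EllipticCurves.IwasawaDual PowerSeries Summit.BirchSwinnertonDyer.Rank1Residual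
  Summit.BirchSwinnertonDyer.Rank1Residual.X5.TowerGap Summit.BirchSwinnertonDyer.Rank1Residual.X5.O1

universe u

namespace Summit.BirchSwinnertonDyer.BirchSwinnertonDyer.Theorems.TowerFiltration

/-! ## §7 `p = 2` over `ℚ`: the EXPONENT gap certificate `e + t < 2ⁿ ⇒ O1.TowerGapAtTwo W` -/

section Curve

variable (W : WeierstrassCurve ℚ) [W.IsElliptic]

/-- **The EXPONENT gap certificate with EXPLICIT local error terms.** `W/ℚ` with odd torsion order; a layer `n`
and `e + t < 2ⁿ`; the EXPONENT certificate `(conj_γ − id)^[e] z = 0` for every `2`-torsion class `z` of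
`Sel_{2^∞}(E/ℚ_n)` and every cyclotomic `κ` with topological generator `γ` (ENGINE A: `s(e) = s(2ⁿ)` in the
`S2| SIGMA` vector); a finite set `S` of places with, at level `n`: `𝒦_{v,n}[2^∞] = 0` off `S` (`h0`),
`#𝒦_{v,n}[2] ≤ C_v` on `S` (`hC`), covering sets of size `≤ N_v` (`hN`); and **every local block small:
`C_v^{N_v} ≤ 2^t` for `v ∈ S`**. Then `O1.TowerGapAtTwo W` with `(m, k) = (e + t, 1)`:
`ν^{t}(A_n[2]) ⊆ Sel_n[2]` (§6) and `ν^{e}(Sel_n[2]) = 0` give `ν^{e+t}(A_n[2]) = 0`, so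
`#X/(2,T^{e+t+1})X = #A_n[2] = #X/(2,T^{e+t})X < 2 · #X/(2,T^{e+t})X` (§2's one-layer count).
[cite: GreenbergLNM1716, §1 p. 60 and §3 pp. 85–90 (Lemmas 3.3–3.5)] [cite: Washington1997, §13.2] -/
theorem towerGapAtTwo_of_exponent_localKernelBounds (htors : ¬ 2 ∣ W.torsionOrder) {n e t : ℕ}
    (het : e + t < 2 ^ n) (S : Finset (HeightOneSpectrum (𝓞 ℚ))) (C N : HeightOneSpectrum (𝓞 ℚ) → ℕ)
    (hstat : ∀ (κ : ZpExtension ℚ 2) (γ : Field.absoluteGaloisGroup ℚ), κ.IsCyclotomic →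
      κ.IsTopGenerator γ → ∀ z : W.selmerLayer κ n, 2 • z = 0 →
        (⇑(W.conjH1 2 (κ.layerSubgroup n) γ -
          AddMonoidHom.id (W.subgroupH1 2 (κ.layerSubgroup n))))^[e]
          (z : W.subgroupH1 2 (κ.layerSubgroup n)) = 0)
    (h0 : ∀ κ : ZpExtension ℚ 2, κ.IsCyclotomic →
      ∀ v ∉ S, W.localTowerKerPrimary κ (v.adicCompletion ℚ) n = ⊥)
    (hC : ∀ κ : ZpExtension ℚ 2, κ.IsCyclotomic → ∀ v ∈ S,
      Finite {x : W.localTowerKerPrimary κ (v.adicCompletion ℚ) n // 2 • x = 0} ∧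
        Nat.card {x : W.localTowerKerPrimary κ (v.adicCompletion ℚ) n // 2 • x = 0} ≤ C v)
    (hN : ∀ κ : ZpExtension ℚ 2, κ.IsCyclotomic → ∀ v ∈ S,
      ∃ R : Finset (Field.absoluteGaloisGroup ℚ), R.card ≤ N v ∧
        ∀ σ : Field.absoluteGaloisGroup ℚ, ∃ ρ ∈ R,
          ∃ δ : Field.absoluteGaloisGroup (v.adicCompletion ℚ), ∃ τ ∈ κ.layerSubgroup n,
            σ = resGal (K := ℚ) (v.adicCompletion ℚ) δ * ρ * τ)
    (hexp : ∀ v ∈ S, C v ^ N v ≤ 2 ^ t) : TowerGapAtTwo W := by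
  intro κ γ hκ hγ _ D
  haveI : Module.Finite (IwasawaAlgebra 2) D.X := D.module_finite_holds hγ
  have hK := Iwasawa.forall_smul_eq_zero_imp_of_not_dvd_torsionOrder W htors
  choose! R hRcard hRcov using hN κ hκ
  -- `1 ≤ C v` on `S`, hence `C_v^{#R_v} ≤ C_v^{N_v} ≤ 2^t`
  have hCpos : ∀ v ∈ S, 1 ≤ C v := fun v hv ↦ by
    haveI := (hC κ hκ v hv).1
    haveI : Nonempty {x : W.localTowerKerPrimary κ (v.adicCompletion ℚ) n // 2 • x = 0} :=
      ⟨⟨0, smul_zero _⟩⟩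
    exact Nat.succ_le_of_lt (lt_of_lt_of_le Nat.card_pos (hC κ hκ v hv).2)
  have hexp' : ∀ v ∈ S, C v ^ (R v).card ≤ 2 ^ t := fun v hv ↦
    (Nat.pow_le_pow_right (hCpos v hv) (hRcard v hv)).trans (hexp v hv)
  haveI hfin := TowerLayer.finite_layerClasses W κ D hK n
  set ν : W.subgroupH1 2 (κ.layerSubgroup n) →+ W.subgroupH1 2 (κ.layerSubgroup n) :=
    W.conjH1 2 (κ.layerSubgroup n) γ - AddMonoidHom.id (W.subgroupH1 2 (κ.layerSubgroup n)) with hν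
  -- `ν^[m]` kills `A_n[2]` for `m ≥ e + t`
  have hkill : ∀ m, e + t ≤ m → ∀ y ∈ W.selmerInftyPreimage κ n, 2 • y = 0 → (⇑ν)^[m] y = 0 := by
    intro m hm y hy hpy
    obtain ⟨hsel, hp2⟩ := iterate_conjSubId_mem_selmerLayer_of_localKernelBounds W κ (γ := γ) S C R
      (h0 κ hκ) (hC κ hκ) hRcov hexp' hfin hy hpy
    have h1 : (⇑ν)^[e] ((⇑ν)^[t] y) = 0 :=
      hstat κ γ hκ hγ ⟨_, hsel⟩ (TowerLayer.nsmul_mk_eq_zero _ _ hp2)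
    rw [show m = (m - (e + t)) + (e + t) by omega, Function.iterate_add_apply, Function.iterate_add_apply, h1,
      iterate_map_zero]
  have hcount : ∀ m, e + t ≤ m →
      Nat.card {z : W.selmerInftyPreimage κ n // 2 • z = 0 ∧ (⇑ν)^[m] (z : W.subgroupH1 2 (κ.layerSubgroup n)) = 0} =
        Nat.card {z : W.selmerInftyPreimage κ n // 2 • z = 0} := fun m hm ↦
    Nat.card_congr (Equiv.subtypeEquivRight fun z ↦ ⟨fun h ↦ h.1, fun h ↦ ⟨h, hkill m hm z.1 z.2 (by
      have := congrArg (fun w : W.selmerInftyPreimage κ n ↦ (w : W.subgroupH1 2 (κ.layerSubgroup n))) h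
      simpa using this)⟩⟩)
  haveI : Nonempty {z : W.selmerInftyPreimage κ n // 2 • z = 0} := ⟨⟨0, smul_zero _⟩⟩
  have hpos : 0 < Nat.card {z : W.selmerInftyPreimage κ n // 2 • z = 0} := Nat.card_pos
  refine ⟨e + t, 1, ?_⟩
  rw [natCard_quotient_towerIdeal_eq_natCard_layerFiltration W κ D hγ hK n (m := e + t + 1) (by omega),
    natCard_quotient_towerIdeal_eq_natCard_layerFiltration W κ D hγ hK n (m := e + t) (by omega),
    hcount (e + t + 1) (by omega), hcount (e + t) le_rfl, pow_one]
  omega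

/-- **The same, SHARP covers built in** (`N_v = 1` at the prime over `2`, `N_v = 2^{min(n, v₂(ℓ_v² − 1) − 3)}` at an odd
`v`; tower-1's `TowerLayer.cover_singleton_at_p` / `exists_cover_card_le_odd_two`): the exact interface of part 3's
`towerGapAtTwo_of_filtration_localKernelBounds_sharp` with the window data `(hlow, hup, harith)` replaced by the exponent
certificate `hstat` and the block bounds `C_v^{N_v} ≤ 2^t`, `e + t < 2ⁿ`. [cite: GreenbergLNM1716, §3 pp. 85–90]
[cite: Washington1997, §13.1] -/
theorem towerGapAtTwo_of_exponent_localKernelBounds_sharp (htors : ¬ 2 ∣ W.torsionOrder)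
    {n e t : ℕ} (het : e + t < 2 ^ n) (S : Finset (HeightOneSpectrum (𝓞 ℚ)))
    (C : HeightOneSpectrum (𝓞 ℚ) → ℕ)
    (hstat : ∀ (κ : ZpExtension ℚ 2) (γ : Field.absoluteGaloisGroup ℚ), κ.IsCyclotomic →
      κ.IsTopGenerator γ → ∀ z : W.selmerLayer κ n, 2 • z = 0 →
        (⇑(W.conjH1 2 (κ.layerSubgroup n) γ -
          AddMonoidHom.id (W.subgroupH1 2 (κ.layerSubgroup n))))^[e]
          (z : W.subgroupH1 2 (κ.layerSubgroup n)) = 0)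
    (h0 : ∀ κ : ZpExtension ℚ 2, κ.IsCyclotomic →
      ∀ v ∉ S, W.localTowerKerPrimary κ (v.adicCompletion ℚ) n = ⊥)
    (hC : ∀ κ : ZpExtension ℚ 2, κ.IsCyclotomic → ∀ v ∈ S,
      Finite {x : W.localTowerKerPrimary κ (v.adicCompletion ℚ) n // 2 • x = 0} ∧
        Nat.card {x : W.localTowerKerPrimary κ (v.adicCompletion ℚ) n // 2 • x = 0} ≤ C v)
    (hexp : ∀ v ∈ S, C v ^
        (if ((2 : ℕ) : 𝓞 ℚ) ∈ v.asIdeal then 1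
          else 2 ^ min n (padicValNat 2 (Rat.HeightOneSpectrum.natGenerator v ^ 2 - 1) - 3)) ≤ 2 ^ t) :
    TowerGapAtTwo W := by
  refine towerGapAtTwo_of_exponent_localKernelBounds W htors het S C
    (fun v ↦ if ((2 : ℕ) : 𝓞 ℚ) ∈ v.asIdeal then 1
      else 2 ^ min n (padicValNat 2 (Rat.HeightOneSpectrum.natGenerator v ^ 2 - 1) - 3))
    hstat h0 hC (fun κ hκ v _ ↦ ?_) hexp
  by_cases h2 : ((2 : ℕ) : 𝓞 ℚ) ∈ v.asIdeal
  · refine ⟨{1}, by rw [if_pos h2, Finset.card_singleton], ?_⟩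
    exact TowerLayer.cover_singleton_at_p κ hκ v h2 n
  · rw [if_neg h2]
    exact TowerLayer.exists_cover_card_le_odd_two hκ v h2 n

end Curve

end Summit.BirchSwinnertonDyer.BirchSwinnertonDyer.Theorems.TowerFiltration

end
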